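import Literature.Analysis.FunctionSpaces.SobolevTraceRellichProofs
import HarnessLib

/-!
# The Kolmogorov–M. Riesz–Fréchet compactness criterion in `L^p` (sufficiency)

Topic: Analysis / FunctionSpaces (next to the Rellich–Kondrachov files `SobolevDomainProofs`,
`SobolevTraceRellichProofs`, whose mollification and Arzelà–Ascoli tools are reused). Two
standard facts on a finite-dimensional real normed space `E'` with an additive Haar measure `μ`,
both **proved**:

* `lintegral_enorm_normed_convolution_sub_self_rpow_le_of_translate` — the mollification error
  is controlled by the translation modulus: for the normalised bump `ρ` of outer radius `δ`, a
  locally integrable `φ` and `1 ≤ q`,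
  `∫ ‖(ρ ⋆ φ) x - φ x‖^q dμ ≤ sup_{‖y‖ ≤ δ} ∫ ‖φ (x - y) - φ x‖^q dμ`
  (Jensen for the probability measure `ρ dμ` and Tonelli; Adams, *Sobolev Spaces* (1975), proof
  of Thm. 2.21, display (25); Brezis, *Functional Analysis* (2011), proof of Thm. 4.26, Step 1).
* `exists_finset_eLpNorm_sub_lt_of_translate` — **Kolmogorov–M. Riesz–Fréchet, sufficiency**
  (Adams 1975, Thm. 2.21; Brezis 2011, Thm. 4.26 with Cor. 4.27): a family `u i ∈ L^p(μ)`,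
  `1 ≤ p < ∞`, vanishing off a fixed compact set, bounded in `L^p`, and with translations
  `‖u i (· - y) - u i‖_p → 0` as `y → 0` *uniformly in `i`*, is totally bounded in `L^p(μ)`:
  for every `ε > 0` finitely many members are `ε`-dense. Proof as printed in Adams: mollify at
  scale `δ(ε)`, the mollified family is equibounded, equi-Lipschitz and supported in a fixed
  compact set (`RellichDomain.norm_normed_convolution_le_of_integrable`,
  `RellichDomain.dist_normed_convolution_le_of_integrable`), Arzelà–Ascoli
  (`exists_finset_forall_norm_sub_lt`), and the sup norm controls the `L^p` norm on a set of
  finite measure (`eLpNorm_le_of_forall_norm_le_of_support_subset`).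

The necessity half of the criterion and the version on sets of infinite measure (with the extra
tail condition) are not needed here and not formalised.

## References

* R. A. Adams, *Sobolev Spaces*, Academic Press (1975), Thm. 2.21 (and its proof). [Adams1975]
* H. Brezis, *Functional Analysis, Sobolev Spaces and Partial Differential Equations*, Springer
  (2011), Thm. 4.26, Cor. 4.27.
* Mathlib: `ContDiffBump.normed`, `MeasureTheory.convolution`; tree: `SobolevDomainProofs`
  (`lintegral_rpow_lintegral_le`, `exists_finset_forall_norm_sub_lt`,
  `eLpNorm_le_of_forall_norm_le_of_support_subset`, `support_normed_convolution_subset`),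
  `SobolevTraceRellichProofs` (`RellichDomain.*_of_integrable`).
-/

noncomputable section

open MeasureTheory Set Filter Function Metric TopologicalSpace ContinuousLinearMap
open scoped ENNReal NNReal Convolution Topology Pointwise

namespace Literature.Analysis.FunctionSpaces

variable {E' : Type*} [NormedAddCommGroup E'] [NormedSpace ℝ E'] [MeasurableSpace E']
  [BorelSpace E'] [FiniteDimensional ℝ E']
variable {F : Type*} [NormedAddCommGroup F] [NormedSpace ℝ F] [CompleteSpace F]

/-! ## Mollification error versus translation modulus -/

/-- **Mollification error is bounded by the translation modulus** (`lintegral` form): for the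
normalised bump function `ρ` with outer radius `δ = ρ.rOut`, a strongly measurable locally
integrable `φ`, `1 ≤ q < ∞`, and any `M` with `∫ ‖φ (x - y) - φ x‖^q dμ(x) ≤ M` for all
`‖y‖ ≤ δ`, one has `∫ ‖(ρ ⋆ φ) x - φ x‖^q dμ(x) ≤ M`. Proof:
`(ρ ⋆ φ) x - φ x = ∫ ρ(y) (φ(x-y) - φ(x)) dμ(y)` since `∫ ρ dμ = 1`; Jensen for the probability
measure `ρ dμ`, Tonelli, and `supp ρ ⊆ B(0, δ)` (Adams 1975, proof of Thm. 2.21, display (25);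
Brezis 2011, proof of Thm. 4.26, Step 1: `‖ρₙ ⋆ f - f‖_p ≤ ε` once `‖τ_h f - f‖_p ≤ ε` for
`|h| ≤ 1/n`). [cite: Adams1975, Thm. 2.21 (proof, display (25))] -/
theorem lintegral_enorm_normed_convolution_sub_self_rpow_le_of_translate
    (μ : Measure E') [μ.IsAddHaarMeasure] {φ : E' → F} (hφm : StronglyMeasurable φ)
    (hφ : LocallyIntegrable φ μ) (ρ : ContDiffBump (0 : E')) {q : ℝ} (hq : 1 ≤ q) {M : ℝ≥0∞}
    (hM : ∀ y ∈ closedBall (0 : E') ρ.rOut, ∫⁻ x, ‖φ (x - y) - φ x‖ₑ ^ q ∂μ ≤ M) :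
    ∫⁻ x, ‖(ρ.normed μ ⋆[lsmul ℝ ℝ, μ] φ : E' → F) x - φ x‖ₑ ^ q ∂μ ≤ M := by
  have hq0 : 0 ≤ q := by linarith
  set ρN : E' → ℝ := ρ.normed μ with hρN
  have hρi : ∫ y, ρN y ∂μ = 1 := ρ.integral_normed
  have hρnn : ∀ y, 0 ≤ ρN y := ρ.nonneg_normed
  have hρc : Continuous ρN := ρ.continuous_normed
  have hρcs : HasCompactSupport ρN := ρ.hasCompactSupport_normed
  have hρint : Integrable ρN μ := hρc.integrable_of_hasCompactSupport hρcs
  -- Step 1: pointwise bound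
  have h1 : ∀ x, ‖(ρN ⋆[lsmul ℝ ℝ, μ] φ : E' → F) x - φ x‖ₑ ≤
      ∫⁻ y, ENNReal.ofReal (ρN y) * ‖φ (x - y) - φ x‖ₑ ∂μ := by
    intro x
    have hint1 : Integrable (fun y => ρN y • φ (x - y)) μ :=
      hρcs.convolutionExists_left (lsmul ℝ ℝ) hρc hφ x
    have hint2 : Integrable (fun y => ρN y • φ x) μ :=
      (hρc.smul continuous_const).integrable_of_hasCompactSupport hρcs.smul_right
    have heq : (ρN ⋆[lsmul ℝ ℝ, μ] φ : E' → F) x - φ x = ∫ y, ρN y • (φ (x - y) - φ x) ∂μ := by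
      rw [convolution_lsmul]
      simp_rw [smul_sub]
      rw [integral_sub hint1 hint2, integral_smul_const, hρi, one_smul]
    rw [heq]
    refine (enorm_integral_le_lintegral_enorm _).trans (le_of_eq (lintegral_congr fun y => ?_))
    rw [enorm_smul, Real.enorm_eq_ofReal (hρnn y)]
  -- Step 2: the probability measure `ρN • μ`, Jensen and Tonelli
  have hρm : Measurable fun y => ENNReal.ofReal (ρN y) :=
    ENNReal.measurable_ofReal.comp hρc.measurable
  have hlin : ∫⁻ y, ENNReal.ofReal (ρN y) ∂μ = 1 := by
    rw [← ofReal_integral_eq_lintegral_ofReal hρint (ae_of_all _ hρnn), hρi, ENNReal.ofReal_one]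
  set ν : Measure E' := μ.withDensity fun y => ENNReal.ofReal (ρN y) with hν
  haveI : IsProbabilityMeasure ν :=
    ⟨by rw [hν, withDensity_apply _ MeasurableSet.univ, Measure.restrict_univ, hlin]⟩
  set G : E' → E' → ℝ≥0∞ := fun x y => ‖φ (x - y) - φ x‖ₑ with hG_def
  have hG : Measurable (uncurry G) := by
    have h1 : StronglyMeasurable fun p : E' × E' => φ (p.1 - p.2) - φ p.1 :=
      (hφm.comp_measurable (measurable_fst.sub measurable_snd)).sub
        (hφm.comp_measurable measurable_fst)
    exact h1.enorm
  calc ∫⁻ x, ‖(ρN ⋆[lsmul ℝ ℝ, μ] φ : E' → F) x - φ x‖ₑ ^ q ∂μ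
        ≤ ∫⁻ x, (∫⁻ y, G x y ∂ν) ^ q ∂μ := by
          refine lintegral_mono fun x => ENNReal.rpow_le_rpow ?_ hq0
          rw [hν, lintegral_withDensity_eq_lintegral_mul μ hρm hG.of_uncurry_left]
          exact h1 x
    _ ≤ ∫⁻ y, ∫⁻ x, G x y ^ q ∂μ ∂ν := lintegral_rpow_lintegral_le hG hq
    _ = ∫⁻ y, ENNReal.ofReal (ρN y) * ∫⁻ x, G x y ^ q ∂μ ∂μ := by
          rw [hν, lintegral_withDensity_eq_lintegral_mul μ hρm
            ((hG.pow_const q).lintegral_prod_left)]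
          rfl
    _ ≤ ∫⁻ y, ENNReal.ofReal (ρN y) * M ∂μ := by
          refine lintegral_mono fun y => ?_
          by_cases hy : ‖y‖ < ρ.rOut
          · gcongr
            exact hM y (mem_closedBall_zero_iff.2 hy.le)
          · have hy' : y ∉ Function.support ρN := by
              rw [hρN, ρ.support_normed_eq]
              simpa using hy
            rw [Function.notMem_support.1 hy']
            simp
    _ = M := by rw [lintegral_mul_const _ hρm, hlin, one_mul]

/-- `eLpNorm` form of `lintegral_enorm_normed_convolution_sub_self_rpow_le_of_translate`: if
`‖φ (· - y) - φ‖_{L^p(μ)} ≤ η` for all `‖y‖ ≤ ρ.rOut` (`1 ≤ p < ∞`), then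
`‖ρ ⋆ φ - φ‖_{L^p(μ)} ≤ η` (Brezis 2011, proof of Thm. 4.26, Step 1). [cite: Adams1975, Thm. 2.21 (proof, display (25))] -/
theorem eLpNorm_normed_convolution_sub_self_le_of_translate
    (μ : Measure E') [μ.IsAddHaarMeasure] {φ : E' → F} (hφm : StronglyMeasurable φ)
    (hφ : LocallyIntegrable φ μ) (ρ : ContDiffBump (0 : E')) {p : ℝ≥0∞} (hp : 1 ≤ p)
    (hp' : p ≠ ∞) {η : ℝ≥0∞}
    (hη : ∀ y ∈ closedBall (0 : E') ρ.rOut, eLpNorm (fun x => φ (x - y) - φ x) p μ ≤ η) :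
    eLpNorm ((ρ.normed μ ⋆[lsmul ℝ ℝ, μ] φ : E' → F) - φ) p μ ≤ η := by
  have hp0 : p ≠ 0 := (zero_lt_one.trans_le hp).ne'
  have hq : 1 ≤ p.toReal := by
    rw [← ENNReal.toReal_one]; exact ENNReal.toReal_mono hp' hp
  have hq0 : 0 < p.toReal := one_pos.trans_le hq
  rw [eLpNorm_eq_lintegral_rpow_enorm_toReal hp0 hp']
  have hM : ∀ y ∈ closedBall (0 : E') ρ.rOut,
      ∫⁻ x, ‖φ (x - y) - φ x‖ₑ ^ p.toReal ∂μ ≤ η ^ p.toReal := by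
    intro y hy
    have h := hη y hy
    rw [eLpNorm_eq_lintegral_rpow_enorm_toReal hp0 hp'] at h
    have h' := ENNReal.rpow_le_rpow h hq0.le
    rwa [← ENNReal.rpow_mul, one_div, inv_mul_cancel₀ hq0.ne', ENNReal.rpow_one] at h'
  have h := lintegral_enorm_normed_convolution_sub_self_rpow_le_of_translate μ hφm hφ ρ hq hM
  calc (∫⁻ x, ‖((ρ.normed μ ⋆[lsmul ℝ ℝ, μ] φ : E' → F) - φ) x‖ₑ ^ p.toReal ∂μ) ^ (1 / p.toReal)
        ≤ (η ^ p.toReal) ^ (1 / p.toReal) := ENNReal.rpow_le_rpow h (by positivity)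
    _ = η := by rw [← ENNReal.rpow_mul, one_div, mul_inv_cancel₀ hq0.ne', ENNReal.rpow_one]

/-! ## The Kolmogorov–Riesz–Fréchet criterion -/

variable [ProperSpace F]

/-- **Kolmogorov–M. Riesz–Fréchet compactness criterion, sufficiency** (Adams, *Sobolev Spaces*
(1975), Thm. 2.21; Brezis 2011, Thm. 4.26 / Cor. 4.27). Let `1 ≤ p < ∞`, `μ` an additive Haar
measure on the finite-dimensional space `E'`, `F` proper (e.g. finite-dimensional), and let
`u i : E' → F` (`i : ι`) be a family of a.e.-strongly measurable functions vanishing off a fixed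
compact set `K`, bounded in `L^p(μ)` (`‖u i‖_p ≤ A < ∞`), whose translations are
equicontinuous in `L^p`: for every `ε > 0` there is `δ > 0` with
`‖u i (· - y) - u i‖_{L^p(μ)} ≤ ε` for all `i` and all `‖y‖ ≤ δ`. Then the family is totally
bounded in `L^p(μ)`: for every `ε > 0` there is a finite set `s` of indices such that every
`u i` is within `ε` of some `u j`, `j ∈ s`. Proof as in Adams (sufficiency part): mollify at
scale `δ(ε/4)` (`eLpNorm_normed_convolution_sub_self_le_of_translate`), apply Arzelà–Ascoli to
the mollified family (`exists_finset_forall_norm_sub_lt`), and compare sup and `L^p` norms on the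
compact `1`-neighbourhood of `K`. [cite: Adams1975, Thm. 2.21] -/
theorem exists_finset_eLpNorm_sub_lt_of_translate (μ : Measure E') [μ.IsAddHaarMeasure]
    {p : ℝ≥0∞} (hp : 1 ≤ p) (hp' : p ≠ ∞) {K : Set E'} (hK : IsCompact K) {ι : Type*}
    (u : ι → E' → F) (hum : ∀ i, AEStronglyMeasurable (u i) μ)
    (huK : ∀ i x, x ∉ K → u i x = 0) {A : ℝ≥0∞} (hA : A ≠ ∞) (huA : ∀ i, eLpNorm (u i) p μ ≤ A)
    (hmod : ∀ ε : ℝ≥0∞, 0 < ε → ∃ δ : ℝ, 0 < δ ∧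
      ∀ i, ∀ y : E', ‖y‖ ≤ δ → eLpNorm (fun x => u i (x - y) - u i x) p μ ≤ ε)
    {ε : ℝ≥0∞} (hε : 0 < ε) :
    ∃ s : Finset ι, ∀ i, ∃ j ∈ s, eLpNorm (u i - u j) p μ < ε := by
  -- reduce to finite `ε`
  wlog hεt : ε ≠ ∞ generalizing ε
  · obtain ⟨s, hs⟩ := this one_pos ENNReal.one_ne_top
    refine ⟨s, fun n => (hs n).imp fun m hm => ⟨hm.1, hm.2.trans_le ?_⟩⟩
    rw [not_ne_iff.1 hεt]; exact le_top
  have hε' : 0 < ε.toReal := ENNReal.toReal_pos hε.ne' hεt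
  have hεe : ε = ENNReal.ofReal ε.toReal := (ENNReal.ofReal_toReal hεt).symm
  have hp0 : p ≠ 0 := (zero_lt_one.trans_le hp).ne'
  have hq : 1 ≤ p.toReal := by rw [← ENNReal.toReal_one]; exact ENNReal.toReal_mono hp' hp
  have hq0 : 0 < p.toReal := one_pos.trans_le hq
  have hKm : MeasurableSet K := hK.isClosed.measurableSet
  ---- strongly measurable representatives vanishing off `K`
  set v : ι → E' → F := fun i => K.indicator ((hum i).mk (u i)) with hv_def
  have hvm : ∀ i, StronglyMeasurable (v i) := fun i =>
    (hum i).stronglyMeasurable_mk.indicator hKm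
  have hv0 : ∀ i x, x ∉ K → v i x = 0 := fun i x hx => indicator_of_notMem hx _
  have hvu : ∀ i, v i =ᵐ[μ] u i := fun i => by
    have h1 : K.indicator ((hum i).mk (u i)) =ᵐ[μ] K.indicator (u i) :=
      (hum i).ae_eq_mk.symm.indicator
    have h2 : K.indicator (u i) = u i := by
      funext x
      by_cases hx : x ∈ K
      · exact indicator_of_mem hx _
      · rw [indicator_of_notMem hx, huK i x hx]
    simpa only [hv_def, h2] using h1
  have hvA : ∀ i, eLpNorm (v i) p μ ≤ A := fun i => by
    rw [eLpNorm_congr_ae (hvu i)]; exact huA i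
  have hvmod : ∀ ε : ℝ≥0∞, 0 < ε → ∃ δ : ℝ, 0 < δ ∧
      ∀ i, ∀ y : E', ‖y‖ ≤ δ → eLpNorm (fun x => v i (x - y) - v i x) p μ ≤ ε := by
    intro ε hε
    obtain ⟨δ, hδ, h⟩ := hmod ε hε
    refine ⟨δ, hδ, fun i y hy => ?_⟩
    have hae : (fun x => v i (x - y) - v i x) =ᵐ[μ] fun x => u i (x - y) - u i x := by
      have ht : (fun x => v i (x - y)) =ᵐ[μ] fun x => u i (x - y) :=
        (measurePreserving_sub_right μ y).quasiMeasurePreserving.ae_eq_comp (hvu i)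
      exact ht.sub (hvu i)
    rw [eLpNorm_congr_ae hae]
    exact h i y hy
  ---- it suffices to treat the representatives
  suffices hsuff : ∃ s : Finset ι, ∀ i, ∃ j ∈ s, eLpNorm (v i - v j) p μ < ε by
    obtain ⟨s, hs⟩ := hsuff
    refine ⟨s, fun i => (hs i).imp fun j hj => ⟨hj.1, ?_⟩⟩
    rw [eLpNorm_congr_ae ((hvu i).symm.sub (hvu j).symm)]
    exact hj.2
  ---- uniform `L¹` bound and integrability
  have hμK : μ K < ∞ := hK.measure_lt_top
  set M₁ : ℝ≥0∞ := A * μ K ^ (1 - p.toReal⁻¹) with hM₁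
  have hM₁t : M₁ ≠ ∞ := ENNReal.mul_ne_top hA
    (ENNReal.rpow_ne_top_of_nonneg (by rw [sub_nonneg]; exact inv_le_one_of_one_le₀ hq) hμK.ne)
  have hL1e : ∀ i, ∫⁻ x, ‖v i x‖ₑ ∂μ ≤ M₁ := fun i => by
    have hs : support (v i) ⊆ K := fun x hx => by_contra fun h => hx (hv0 i x h)
    rw [← eLpNorm_one_eq_lintegral_enorm, ← eLpNorm_restrict_eq_of_support_subset hs]
    refine (eLpNorm_le_eLpNorm_mul_rpow_measure_univ hp
      ((hvm i).aestronglyMeasurable.restrict)).trans ?_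
    rw [eLpNorm_restrict_eq_of_support_subset hs, Measure.restrict_apply_univ,
      ENNReal.toReal_one, div_one, one_div, hM₁]
    gcongr
    exact hvA i
  have hvi : ∀ i, Integrable (v i) μ := fun i =>
    ⟨(hvm i).aestronglyMeasurable, (hL1e i).trans_lt (lt_top_iff_ne_top.2 hM₁t)⟩
  have hL1 : ∀ i, ∫ x, ‖v i x‖ ∂μ ≤ M₁.toReal := fun i => by
    rw [integral_norm_eq_lintegral_enorm (hvm i).aestronglyMeasurable]
    exact ENNReal.toReal_mono hM₁t (hL1e i)
  ---- the scale and the mollifier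
  have hε4 : 0 < ENNReal.ofReal (ε.toReal / 4) := ENNReal.ofReal_pos.2 (by positivity)
  obtain ⟨δ₀, hδ₀, hδ₀mod⟩ := hvmod _ hε4
  set δ : ℝ := min 1 δ₀ with hδ_def
  have hδ : 0 < δ := lt_min one_pos hδ₀
  have hδ1 : δ ≤ 1 := min_le_left _ _
  have hδδ₀ : δ ≤ δ₀ := min_le_right _ _
  let ρ : ContDiffBump (0 : E') := ⟨δ / 2, δ, half_pos hδ, half_lt_self hδ⟩
  have hρ : ρ.rOut = δ := rfl
  set T : ι → E' → F := fun i => (ρ.normed μ ⋆[lsmul ℝ ℝ, μ] v i : E' → F) with hT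
  -- (1) `‖T i - v i‖_p ≤ ε/4`
  have h1 : ∀ i, eLpNorm (T i - v i) p μ ≤ ENNReal.ofReal (ε.toReal / 4) := fun i =>
    eLpNorm_normed_convolution_sub_self_le_of_translate μ (hvm i) (hvi i).locallyIntegrable ρ
      hp hp' fun y hy => hδ₀mod i y ((mem_closedBall_zero_iff.1 hy).trans (hρ.le.trans hδδ₀))
  -- (2) the mollified family is supported in `K'`, equibounded and equi-Lipschitz
  set K' : Set E' := cthickening 1 K with hK'
  have hK'c : IsCompact K' := hK.cthickening
  have hμK' : μ K' < ∞ := hK'c.measure_lt_top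
  have hT0 : ∀ i x, x ∉ K' → T i x = 0 := fun i x hx => by
    by_contra h
    have hx' : x ∈ thickening ρ.rOut (support (v i)) :=
      support_normed_convolution_subset μ ρ (mem_support.2 h)
    have hs : support (v i) ⊆ K := fun y hy => by_contra fun h' => hy (hv0 i y h')
    exact hx (thickening_subset_cthickening_of_le (hρ.le.trans hδ1) _
      (thickening_subset_of_subset _ hs hx'))
  have hIρ : 0 < ∫ y, ρ y ∂μ := ρ.integral_pos
  have hTR : ∀ i x, ‖T i x‖ ≤ (∫ y, ρ y ∂μ)⁻¹ * M₁.toReal := fun i x =>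
    (RellichDomain.norm_normed_convolution_le_of_integrable ρ (hvi i) x).trans
      (mul_le_mul_of_nonneg_left (hL1 i) (inv_nonneg.2 hIρ.le))
  obtain ⟨Lρ, hLρ⟩ := (ρ.contDiff_normed (μ := μ) (n := 1)).lipschitzWith_of_hasCompactSupport
    ρ.hasCompactSupport_normed one_ne_zero
  have hTL : ∀ i, LipschitzWith (Lρ * ⟨M₁.toReal, ENNReal.toReal_nonneg⟩) (T i) := fun i =>
    LipschitzWith.of_dist_le_mul fun x x' =>
      (RellichDomain.dist_normed_convolution_le_of_integrable ρ (hvi i) hLρ x x').trans (by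
        push_cast
        gcongr
        exact hL1 i)
  have hTc : ∀ i, Continuous (T i) := fun i => (hTL i).continuous
  -- (3) Arzelà–Ascoli net for the mollified family
  set η : ℝ := ε.toReal / 4 / ((μ K').toReal ^ p.toReal⁻¹ + 1) with hη_def
  have hη : 0 < η := by positivity
  obtain ⟨s, hs⟩ := exists_finset_forall_norm_sub_lt T hK'c hT0 hTR hTL hη
  have h2 : ∀ i j, (∀ x, ‖T i x - T j x‖ < η) →
      eLpNorm (T i - T j) p μ ≤ ENNReal.ofReal (ε.toReal / 4) := fun i j hij => by
    refine (eLpNorm_le_of_forall_norm_le_of_support_subset μ (K := K')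
      (fun x hx => by simp [hT0 i x hx, hT0 j x hx]) (fun x => (hij x).le) p).trans ?_
    rw [← ENNReal.ofReal_toReal hμK'.ne, ENNReal.ofReal_rpow_of_nonneg ENNReal.toReal_nonneg
      (inv_nonneg.2 hq0.le), ← ENNReal.ofReal_mul (by positivity)]
    apply ENNReal.ofReal_le_ofReal
    calc (μ K').toReal ^ p.toReal⁻¹ * η ≤ ((μ K').toReal ^ p.toReal⁻¹ + 1) * η := by
          gcongr; linarith
      _ = ε.toReal / 4 := by rw [hη_def]; field_simp
  -- (4) assemble
  refine ⟨s, fun i => (hs i).imp fun j hj => ⟨hj.1, ?_⟩⟩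
  have hTm : ∀ k, AEStronglyMeasurable (T k) μ := fun k => (hTc k).aestronglyMeasurable
  have hvm' : ∀ k, AEStronglyMeasurable (v k) μ := fun k => (hvm k).aestronglyMeasurable
  calc eLpNorm (v i - v j) p μ
        = eLpNorm ((v i - T i) + (T i - T j) + (T j - v j)) p μ := by
          congr 1; abel
    _ ≤ eLpNorm (v i - T i) p μ + eLpNorm (T i - T j) p μ + eLpNorm (T j - v j) p μ := by
          refine (eLpNorm_add_le (((hvm' i).sub (hTm i)).add ((hTm i).sub (hTm j)))
            ((hTm j).sub (hvm' j)) hp).trans ?_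
          gcongr
          exact eLpNorm_add_le ((hvm' i).sub (hTm i)) ((hTm i).sub (hTm j)) hp
    _ ≤ ENNReal.ofReal (ε.toReal / 4) + ENNReal.ofReal (ε.toReal / 4) +
          ENNReal.ofReal (ε.toReal / 4) := by
          gcongr
          · rw [← eLpNorm_neg, neg_sub]; exact h1 i
          · exact h2 i j hj.2
          · exact h1 j
    _ < ε := by
          rw [← ENNReal.ofReal_add (by positivity) (by positivity),
            ← ENNReal.ofReal_add (by positivity) (by positivity), hεe,
            ENNReal.ofReal_lt_ofReal_iff hε', ENNReal.toReal_ofReal hε'.le]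
          linarith

end Literature.Analysis.FunctionSpaces
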